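import Literature.LinearAlgebra.Matrix.NumericalRadiusRefinedNormBounds
import Literature.LinearAlgebra.Matrix.FurutaInequality
import Mathlib.Analysis.SpecialFunctions.ContinuousFunctionalCalculus.Rpow.Isometric
import Mathlib.Analysis.Convex.SpecificFunctions.Basic
import HarnessLib

/-!
# Numerical radius bounds through the rotated real parts `H_θ = Re(e^{iθ}T)` (Bhunia–Bag–Paul 2019):
# `w⁴(T) ≤ ¼w²(T²) + ⅛w(T²P + PT²) + (1/16)‖P‖²`, `w³(T) ≤ ¼w(T³) + ¼w(T²T^* + T^*T² + TT^*T)`,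
# `w^{2r}(T) ≤ ½wʳ(T²) + ¼‖(T^*T)ʳ + (TT^*)ʳ‖`, `w(T) ≤ (‖H_φ‖² + ‖H_{φ+π/2}‖²)^{1/2}`,
# `w⁴(T) ≥ ¼C²(T²) + ⅛m(T²P + PT²) + (1/16)‖P‖²`, `w(T) ≥ (‖Re T‖² + m²(Im T))^{1/2}`,
# and the equality cases `T² = 0 ⟹ w(T) = ½‖T^*T + TT^*‖^{1/2}`, `T³ = 0 ⟹ w³(T) = ¼w(T²T^* + T^*T² + TT^*T)`

Hodge foundations lane (`lit-hodgefound`, prover p24 gen 64; matrix-analysis series), the sequel of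
`NumericalRadiusRefinedNormBounds.lean` (p24 gen 64 #1: `w(T) = sup_{|z|=1} ‖Re(zT)‖` in both directions, `w(N) = ‖N‖`
for normal `N`, Kittaneh 2003/2005, Yamazaki 2007).  THEOREMS ONLY: no definition, no named fact, net debt 0.  Complex
square matrices, `‖·‖` the spectral norm (scoped `Matrix.Norms.L2Operator`), `P = T^*T + TT^*` throughout.

DEF-FREE CONVENTIONS (as in the predecessor): unit vector `star x ⬝ᵥ x = 1`, `⟨Tx, x⟩ = star x ⬝ᵥ (T *ᵥ x)`, a bound
`w(T) ≤ c` is `∀ x, star x ⬝ᵥ x = 1 → ‖star x ⬝ᵥ (T *ᵥ x)‖ ≤ c`, `w(T) = r` is `IsGreatest {‖x^*Tx‖ : x^*x = 1} r`;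
the rotated real part `H_θ = Re(e^{iθ}T)` is written for a unit scalar `z` as `½(z•T + (z•T)^*)`; the lower
quantities `C(T) = inf_{‖x‖=1} inf_φ ‖Re(e^{iφ}T)x‖` and the Crawford number `m(T) = inf_{‖x‖=1} |⟨Tx, x⟩|` enter as
HYPOTHESES `c₁² ≤ ‖Re(zT²)x‖²`, `m₁ ≤ |⟨(T²P + PT²)x, x⟩|` for all unit `x`, `z` (so every lower bound of the infimum
is admissible, in particular the infimum itself).

## Source, VERBATIM — P. Bhunia, S. Bag, K. Paul, *Numerical radius inequalities and its applications in estimation of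
## zeros of polynomials*, Linear Algebra Appl. 573 (2019) 166–177 [BhuniaBagPaul2019] (held text `paper:arxiv-1903.03403`,
## pp. 3–6)

§ 1: «It is well known that `w(T) = sup_{θ∈ℝ} ‖H_θ‖`, where `H_θ = Re(e^{iθ}T)`.»
«**Theorem 2.1.** Let `T ∈ B(H)`. Then `w⁴(T) ≤ ¼w²(T²) + ⅛w(T²P + PT²) + (1/16)‖P‖²`, where `P = T^*T + TT^*`.
Proof. … `H_θ = ½(e^{iθ}T + e^{−iθ}T^*) ⇒ 4H_θ² = e^{2iθ}T² + e^{−2iθ}T^{*2} + P ⇒ 16H_θ⁴ = … =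
4(Re(e^{2iθ}T²))² + 2Re(e^{2iθ}(T²P + PT²)) + P² ⇒ ‖H_θ⁴‖ ≤ ¼‖Re(e^{2iθ}T²)‖² + ⅛‖Re(e^{2iθ}(T²P + PT²))‖ +
(1/16)‖P‖²`. Now taking the supremum over `θ ∈ ℝ` …»
«**Theorem 2.3.** Let `T ∈ B(H)`. Then `w³(T) ≤ ¼w(T³) + ¼w(T²T^* + T^*T² + TT^*T)`. Moreover if `T² = 0` then
`w(T) = ½√‖TT^* + T^*T‖` and if `T³ = 0` then `w(T) = (¼w(T²T^* + T^*T² + TT^*T))^{1/3}`. Proof. … `8H_θ³ =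
(e^{2iθ}T² + e^{−2iθ}T^{*2} + T^*T + TT^*)(e^{iθ}T + e^{−iθ}T^*) ⇒ H_θ³ = ¼Re(e^{3iθ}T³) + ¼Re(e^{iθ}(T²T^* + T^*T² +
TT^*T)) ⇒ ‖H_θ³‖ ≤ ¼‖Re(e^{3iθ}T³)‖ + ¼‖Re(e^{iθ}(T²T^* + T^*T² + TT^*T))‖`. … If `T² = 0` then `4H_θ² = T^*T + TT^*`
and so `w(T) = ½√‖TT^* + T^*T‖`. If `T³ = 0` then `H_θ³ = ¼Re(e^{iθ}(T²T^* + T^*T² + TT^*T))` and so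
`w³(T) = ¼w(T²T^* + T^*T² + TT^*T)`.»
«**Theorem 2.5.** Let `T ∈ B(H)`. Then for each `r ≥ 1`, `w^{2r}(T) ≤ ½wʳ(T²) + ¼‖(T^*T)ʳ + (TT^*)ʳ‖`. Proof. …
`H_θ² = ½Re(e^{2iθ}T²) + ¼(T^*T + TT^*) ⇒ ‖H_θ²‖ ≤ ½‖Re(e^{2iθ}T²)‖ + ¼‖T^*T + TT^*‖`. For `r ≥ 1`, `tʳ` and `t^{1/r}`
are convex and concave operator functions respectively and using that we get, `‖H_θ²‖ʳ ≤ {½‖Re(e^{2iθ}T²)‖ +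
½‖(T^*T + TT^*)/2‖}ʳ ≤ ½‖Re(e^{2iθ}T²)‖ʳ + ½‖(T^*T + TT^*)/2‖ʳ ≤ ½‖Re(e^{2iθ}T²)‖ʳ + ½‖(((T^*T)ʳ + (TT^*)ʳ)/2)^{1/r}‖ʳ =
½‖Re(e^{2iθ}T²)‖ʳ + ½‖((T^*T)ʳ + (TT^*)ʳ)/2‖` …»  (only SCALAR convexity of `tʳ` and OPERATOR concavity of `t^{1/r}`
are used, and that is what is formalized).
«**Theorem 2.7.** Let `T ∈ B(H)`. Then `w(T) ≤ inf_{φ∈ℝ} √(‖H_φ‖² + ‖H_{φ+π/2}‖²)` where `H_φ = Re(e^{iφ}T)`.»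
«**Theorem 3.1.** Let `T ∈ B(H)`. Then `w⁴(T) ≥ ¼C²(T²) + ⅛m(T²P + PT²) + (1/16)‖P‖²`, where `P = T^*T + TT^*`,
`C(T) = inf_{x∈H,‖x‖=1} inf_{φ∈ℝ} ‖Re(e^{iφ}T)x‖`. Proof. … let `θ` be a real number such that
`e^{2iθ}⟨(T²P + PT²)x, x⟩ = |⟨(T²P + PT²)x, x⟩|`. Then … `16w⁴(T) ≥ ‖4(Re(e^{2iθ}T²))² + 2Re(e^{2iθ}(T²P + PT²)) + P²‖
≥ … = 4‖(Re(e^{2iθ}T²))x‖² + 2|⟨(T²P + PT²)x, x⟩| + ‖Px‖² ≥ 4C²(T²) + 2m(T²P + PT²) + ‖Px‖² ⇒ 16w⁴(T) ≥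
4C²(T²) + 2m(T²P + PT²) + sup_{‖x‖=1} ‖Px‖² = … + ‖P‖²`.»  «**Remark 3.2.** Kittaneh [FK] proved that
`w²(T) ≥ ¼‖P‖`, which easily follows from our Theorem 3.1.» (That bound is the predecessor's
`kittaneh2005_quarter_norm_le_sq`.)
«**Theorem 3.3.** Let `T ∈ B(H)`. Then `w(T) ≥ √(‖Re(T)‖² + m²(Im(T)))` and `w(T) ≥ √(‖Im(T)‖² + m²(Re(T)))`.
Proof. First we assume `‖Re(T)‖ = |λ|`. … `|⟨Tx_n, x_n⟩|² = (⟨Re(T)x_n, x_n⟩)² + (⟨Im(T)x_n, x_n⟩)² ≥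
(⟨Re(T)x_n, x_n⟩)² + m²(Im(T))` …»  «**Corollary 3.4.** Let `T ∈ B(H)`. If either `Re(T)` or `Im(T)` is unitarily
equivalent to a scalar operator then `w(T) = √(‖Re(T)‖² + ‖Im(T)‖²)`.»

## What is proved (all `theorem`s), and the roads

* § 1 the algebra of `H_z = ½(z•T + (z•T)^*)`, `|z| = 1`: `hermitianPart_smul_eq`, **`hermitianPart_smul_mul_self`**
  (`4H_z² = (z²T² + (z²T²)^*) + P`), **`hermitianPart_smul_pow_three`** (`8H_z³ = (z³T³ + (z³T³)^*) + (zQ + (zQ)^*)`,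
  `Q = T²T^* + T^*T² + TT^*T`), `sixteen_pow_four` (`16H_z⁴ = (W + W^*)² + ((WP + PW) + (WP + PW)^*) + P²`,
  `W = z²T²`), the `C⋆`-identities `norm_mul_self_of_isHermitian` (`‖H²‖ = ‖H‖²`), `norm_pow_three_of_isHermitian`,
  `norm_pow_four_of_isHermitian`, and the rotation lemmas `exists_unit_mul_eq_norm` (`z·w = |w|`),
  `exists_unit_sq_mul_eq_norm` (`z²·w = |w|`), **`exists_norm_quadForm_eq_quadForm_hermitianPart_smul`** (for each unit
  `x` some `H_z` has `x^*H_zx = |x^*Tx|`, hence `|x^*Tx| ≤ ‖H_z‖` — the pointwise content of «`w(T) = sup_θ ‖H_θ‖`»).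
* § 2 **Theorem 2.1** `bhuniaBagPaul_thm_2_1` (`|x^*Tx|⁴ ≤ ¼a² + ⅛b + (1/16)‖P‖²` whenever `w(T²) ≤ a`,
  `w(T²P + PT²) ≤ b`).
* § 3 **Theorem 2.3** `bhuniaBagPaul_thm_2_3` (`|x^*Tx|³ ≤ ¼a + ¼b` whenever `w(T³) ≤ a`, `w(Q) ≤ b`), and the two
  equality cases **`isGreatest_quadForm_of_sq_eq_zero'`** (`T² = 0 ⟹ w(T) = ½√‖T^*T + TT^*‖`, attained) and
  **`numericalRadius_pow_three_of_pow_three_eq_zero`** (`T³ = 0`, `w(T) = M`, `w(Q) = M'` ⟹ `M³ = ¼M'`).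
* § 4 **Theorem 2.5** `bhuniaBagPaul_thm_2_5` (`|x^*Tx|^{2r} ≤ ½aʳ + ¼‖(T^*T)ʳ + (TT^*)ʳ‖`, `r ≥ 1`, `w(T²) ≤ a`; scalar
  convexity of `tʳ` = Mathlib `convexOn_rpow`, operator concavity of `t^{1/r}` = the tree's
  `FurutaInequality.half_smul_rpow_add_half_smul_rpow_le`, `‖X^{1/r}‖ = ‖X‖^{1/r}` = Mathlib `CFC.norm_rpow`).
* § 5 **Theorem 2.7** `bhuniaBagPaul_thm_2_7` (`|x^*Tx|² ≤ ‖Re(zT)‖² + ‖Re(izT)‖²` for every unit `z`; `φ = 0` is the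
  predecessor's `norm_sq_quadForm_le_norm_sq_add_norm_sq`, Remark 2.8).
* § 6 **Theorem 3.1** `bhuniaBagPaul_thm_3_1_pointwise` (for each unit `x`: `4c₁² + 2m₁ + ‖Px‖² ≤ 16c⁴`) and
  **`bhuniaBagPaul_thm_3_1`** (`¼c₁² + ⅛m₁ + (1/16)‖P‖² ≤ c⁴` whenever `w(T) ≤ c`, `C²(T²) ≥ c₁²`, `m(T²P + PT²) ≥ m₁`).
* § 7 **Theorem 3.3** `bhuniaBagPaul_thm_3_3` / `bhuniaBagPaul_thm_3_3'` and **Corollary 3.4**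
  `isGreatest_quadForm_of_skewHermitianPart_eq_smul_one` / `isGreatest_quadForm_of_hermitianPart_eq_smul_one` (a scalar
  imaginary, resp. real, part: `w(T) = √(‖Re T‖² + ‖Im T‖²)`, attained).

## References

* [BhuniaBagPaul2019] P. Bhunia, S. Bag, K. Paul, LAA 573 (2019) 166–177, doi:10.1016/j.laa.2019.03.017 — Theorems 2.1,
  2.3, 2.5, 2.7, 3.1, 3.3, Corollary 3.4, Remarks 2.8, 3.2.
* [Kittaneh2005] F. Kittaneh, Studia Math. 168 (2005) 73–80 — Theorem 1 (Remark 3.2).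
-/

noncomputable section

open Matrix
open scoped ComplexOrder MatrixOrder ComplexConjugate Matrix.Norms.L2Operator

namespace Literature.LinearAlgebra.Matrix.NumericalRadiusRotatedRealPart

open Literature.LinearAlgebra.Matrix.NumericalRadiusRefinedNormBounds
open Literature.LinearAlgebra.Matrix.LoewnerHeinzInequality (posSemidef_rpow rpow_rpow_of_nonneg rpow_one)
open Literature.LinearAlgebra.Matrix.FurutaInequality (half_smul_rpow_add_half_smul_rpow_le)

variable {n : Type*} [Fintype n] [DecidableEq n]

/-! ## § 1. The algebra of `H_z = ½(z•T + (z•T)^*)` and the rotation lemmas -/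

section Algebra

omit [DecidableEq n] in
/-- The quadratic form of a scalar multiple: `x^*(zT)x = z·x^*Tx`. [folklore] -/
private theorem quadForm_smul (z : ℂ) (T : Matrix n n ℂ) (x : n → ℂ) :
    star x ⬝ᵥ ((z • T) *ᵥ x) = z * (star x ⬝ᵥ (T *ᵥ x)) := by
  rw [smul_mulVec, dotProduct_smul, smul_eq_mul]

omit [DecidableEq n] in
/-- `conj(x^*Ax) = x^*A^*x`. [folklore] -/
private theorem conj_quadForm' (A : Matrix n n ℂ) (x : n → ℂ) :
    conj (star x ⬝ᵥ (A *ᵥ x)) = star x ⬝ᵥ (Aᴴ *ᵥ x) := by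
  rw [← Complex.star_def, ← star_dotProduct_star, star_star, star_mulVec, ← dotProduct_mulVec]

/-- A unit scalar times its conjugate is one. [folklore] -/
private theorem mul_conj_of_norm_eq_one {z : ℂ} (hz : ‖z‖ = 1) : z * conj z = 1 := by
  rw [Complex.mul_conj, Complex.normSq_eq_norm_sq, hz]; norm_num

/-- A unit scalar's conjugate times the scalar is one. [folklore] -/
private theorem conj_mul_of_norm_eq_one {z : ℂ} (hz : ‖z‖ = 1) : conj z * z = 1 := by
  rw [mul_comm]; exact mul_conj_of_norm_eq_one hz

variable (T : Matrix n n ℂ)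

omit [Fintype n] [DecidableEq n] in
/-- `H_z = ½(zT + z̄T^*)`. [cite: BhuniaBagPaul2019, Theorem 2.1 (proof: «`H_θ = ½(e^{iθ}T + e^{−iθ}T^*)`»)] -/
theorem hermitianPart_smul_eq (z : ℂ) :
    (2 : ℂ)⁻¹ • (z • T + (z • T)ᴴ) = (2 : ℂ)⁻¹ • (z • T + conj z • Tᴴ) := by
  rw [conjTranspose_smul, Complex.star_def]

omit [Fintype n] [DecidableEq n] in
/-- `H_z` is Hermitian. [cite: BhuniaBagPaul2019, § 1 («`H_θ = Re(e^{iθ}T)`»)] -/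
theorem isHermitian_hermitianPart_smul (z : ℂ) : ((2 : ℂ)⁻¹ • (z • T + (z • T)ᴴ)).IsHermitian :=
  isHermitian_hermitianPart (z • T)

/-- **`4H_z² = (z²T² + (z²T²)^*) + (T^*T + TT^*)`** for `|z| = 1` («`4H_θ² = e^{2iθ}T² + e^{−2iθ}T^{*2} + P`»).
[cite: BhuniaBagPaul2019, Theorem 2.1 (proof)] -/
theorem hermitianPart_smul_mul_self {z : ℂ} (hz : ‖z‖ = 1) :
    (4 : ℂ) • (((2 : ℂ)⁻¹ • (z • T + (z • T)ᴴ)) * ((2 : ℂ)⁻¹ • (z • T + (z • T)ᴴ))) =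
      (z ^ 2 • T ^ 2 + (z ^ 2 • T ^ 2)ᴴ) + (Tᴴ * T + T * Tᴴ) := by
  have hzz := mul_conj_of_norm_eq_one hz
  have hzz' := conj_mul_of_norm_eq_one hz
  rw [conjTranspose_smul, conjTranspose_smul, conjTranspose_pow, Complex.star_def, map_pow]
  simp only [pow_two, smul_add, add_mul, mul_add, smul_mul_smul_comm, hzz, hzz', one_smul]
  module

/-- **`8H_z³ = (z³T³ + (z³T³)^*) + (zQ + (zQ)^*)`**, `Q = T²T^* + T^*T² + TT^*T`, for `|z| = 1` («`8H_θ³ = (e^{2iθ}T² +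
e^{−2iθ}T^{*2} + T^*T + TT^*)(e^{iθ}T + e^{−iθ}T^*) ⇒ H_θ³ = ¼Re(e^{3iθ}T³) + ¼Re(e^{iθ}(T²T^* + T^*T² + TT^*T))`»).
[cite: BhuniaBagPaul2019, Theorem 2.3 (proof)] -/
theorem hermitianPart_smul_pow_three {z : ℂ} (hz : ‖z‖ = 1) :
    (8 : ℂ) • (((2 : ℂ)⁻¹ • (z • T + (z • T)ᴴ)) * ((2 : ℂ)⁻¹ • (z • T + (z • T)ᴴ)) *
        ((2 : ℂ)⁻¹ • (z • T + (z • T)ᴴ))) =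
      (z ^ 3 • T ^ 3 + (z ^ 3 • T ^ 3)ᴴ) +
        (z • (T ^ 2 * Tᴴ + Tᴴ * T ^ 2 + T * Tᴴ * T) + (z • (T ^ 2 * Tᴴ + Tᴴ * T ^ 2 + T * Tᴴ * T))ᴴ) := by
  have hzz := mul_conj_of_norm_eq_one hz
  have hT3 : T ^ 3 = T * T * T := by rw [pow_succ, pow_two]
  rw [hT3, pow_two]
  simp only [conjTranspose_smul, conjTranspose_add, conjTranspose_mul, conjTranspose_conjTranspose, smul_add, add_mul,
    mul_add, smul_mul_assoc, mul_smul_comm, smul_smul, mul_assoc]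
  rw [Complex.star_def, map_pow]
  -- match the coefficients of the eight words in `T`, `T^*`; the scalar identities follow from `z z̄ = 1`
  match_scalars <;> first | ring1 | linear_combination z * hzz | linear_combination (conj z) * hzz

/-- **`16H_z⁴ = (W + W^*)² + ((WP + PW) + (WP + PW)^*) + P²`** with `W = z²T²`, `P = T^*T + TT^*` («`16H_θ⁴ =
4(Re(e^{2iθ}T²))² + 2Re(e^{2iθ}(T²P + PT²)) + P²`», `2Re(X) = X + X^*`). [cite: BhuniaBagPaul2019, Theorem 2.1 (proof)] -/
theorem sixteen_smul_pow_four {z : ℂ} (hz : ‖z‖ = 1) :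
    (16 : ℂ) • (((2 : ℂ)⁻¹ • (z • T + (z • T)ᴴ)) * ((2 : ℂ)⁻¹ • (z • T + (z • T)ᴴ)) *
        (((2 : ℂ)⁻¹ • (z • T + (z • T)ᴴ)) * ((2 : ℂ)⁻¹ • (z • T + (z • T)ᴴ)))) =
      (z ^ 2 • T ^ 2 + (z ^ 2 • T ^ 2)ᴴ) * (z ^ 2 • T ^ 2 + (z ^ 2 • T ^ 2)ᴴ) +
        ((z ^ 2 • (T ^ 2 * (Tᴴ * T + T * Tᴴ) + (Tᴴ * T + T * Tᴴ) * T ^ 2) +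
          (z ^ 2 • (T ^ 2 * (Tᴴ * T + T * Tᴴ) + (Tᴴ * T + T * Tᴴ) * T ^ 2))ᴴ) +
        (Tᴴ * T + T * Tᴴ) * (Tᴴ * T + T * Tᴴ)) := by
  have h4 := hermitianPart_smul_mul_self T hz
  have hPh : (Tᴴ * T + T * Tᴴ)ᴴ = Tᴴ * T + T * Tᴴ := by
    rw [conjTranspose_add, conjTranspose_mul, conjTranspose_mul, conjTranspose_conjTranspose, add_comm]
  have hV : z ^ 2 • (T ^ 2 * (Tᴴ * T + T * Tᴴ) + (Tᴴ * T + T * Tᴴ) * T ^ 2) =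
      (z ^ 2 • T ^ 2) * (Tᴴ * T + T * Tᴴ) + (Tᴴ * T + T * Tᴴ) * (z ^ 2 • T ^ 2) := by
    rw [smul_add, smul_mul_assoc, mul_smul_comm]
  rw [hV, conjTranspose_add, conjTranspose_mul, conjTranspose_mul, hPh]
  -- generalize the atoms `H`, `W`, `P`
  generalize hH : (2 : ℂ)⁻¹ • (z • T + (z • T)ᴴ) = H at h4 ⊢
  generalize hW : z ^ 2 • T ^ 2 = W at h4 ⊢
  generalize hP : Tᴴ * T + T * Tᴴ = P at h4 ⊢
  have h16 : ((4 : ℂ) • (H * H)) * ((4 : ℂ) • (H * H)) = (16 : ℂ) • (H * H * (H * H)) := by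
    rw [smul_mul_smul_comm, show ((4 : ℂ) * 4) = 16 by norm_num]
  rw [← h16, h4]
  noncomm_ring

/-- `‖H²‖ = ‖H‖²` for a Hermitian matrix (the `C⋆`-identity). [folklore] -/
private theorem norm_mul_self_of_isHermitian {H : Matrix n n ℂ} (hH : H.IsHermitian) : ‖H * H‖ = ‖H‖ ^ 2 := by
  rw [sq, ← l2_opNorm_conjTranspose_mul_self, hH.eq]

/-- `‖H⁴‖ = ‖H‖⁴` for a Hermitian matrix. [folklore] -/
private theorem norm_pow_four_of_isHermitian {H : Matrix n n ℂ} (hH : H.IsHermitian) :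
    ‖H * H * (H * H)‖ = ‖H‖ ^ 4 := by
  have h2 : (H * H).IsHermitian := by rw [IsHermitian, conjTranspose_mul, hH.eq]
  rw [norm_mul_self_of_isHermitian h2, norm_mul_self_of_isHermitian hH]
  ring

/-- `‖H³‖ = ‖H‖³` for a Hermitian matrix (`‖H³‖ ≤ ‖H‖³` trivially; `‖H‖⁴ = ‖H⁴‖ ≤ ‖H³‖‖H‖`). [folklore] -/
private theorem norm_pow_three_of_isHermitian {H : Matrix n n ℂ} (hH : H.IsHermitian) :
    ‖H * H * H‖ = ‖H‖ ^ 3 := by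
  refine le_antisymm ?_ ?_
  · calc ‖H * H * H‖ ≤ ‖H * H‖ * ‖H‖ := l2_opNorm_mul _ _
      _ ≤ ‖H‖ * ‖H‖ * ‖H‖ := by gcongr; exact l2_opNorm_mul _ _
      _ = ‖H‖ ^ 3 := by ring
  · have h4 : ‖H‖ ^ 4 ≤ ‖H * H * H‖ * ‖H‖ := by
      rw [← norm_pow_four_of_isHermitian hH, ← Matrix.mul_assoc]
      exact l2_opNorm_mul _ _
    by_cases h0 : ‖H‖ = 0
    · rw [h0]; simp
    · have hpos : 0 < ‖H‖ := lt_of_le_of_ne (norm_nonneg _) (Ne.symm h0)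
      nlinarith [h4, hpos]

/-- **Rotation onto the positive real axis**: every complex number `w` has a unit scalar `z` with `z·w = |w|`.
[folklore] -/
private theorem exists_unit_mul_eq_norm (w : ℂ) : ∃ z : ℂ, ‖z‖ = 1 ∧ z * w = ((‖w‖ : ℝ) : ℂ) := by
  by_cases hw : w = 0
  · exact ⟨1, norm_one, by rw [hw, mul_zero, norm_zero, Complex.ofReal_zero]⟩
  · have hwpos : 0 < ‖w‖ := norm_pos_iff.mpr hw
    refine ⟨((‖w‖ : ℝ) : ℂ)⁻¹ * conj w, ?_, ?_⟩
    · rw [norm_mul, norm_inv, Complex.norm_real, Real.norm_of_nonneg hwpos.le, Complex.norm_conj,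
        inv_mul_cancel₀ hwpos.ne']
    · rw [mul_assoc, mul_comm (conj w) w, Complex.mul_conj, Complex.normSq_eq_norm_sq]
      push_cast
      field_simp

/-- A unit scalar `z` with `z²·w = |w|` (a square root of the phase; «let `θ` be a real number such that
`e^{2iθ}⟨(T²P + PT²)x, x⟩ = |⟨(T²P + PT²)x, x⟩|`»). [cite: BhuniaBagPaul2019, Theorem 3.1 (proof)] -/
theorem exists_unit_sq_mul_eq_norm (w : ℂ) : ∃ z : ℂ, ‖z‖ = 1 ∧ z ^ 2 * w = ((‖w‖ : ℝ) : ℂ) := by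
  obtain ⟨u, hu, huw⟩ := exists_unit_mul_eq_norm w
  obtain ⟨z, hz⟩ := IsAlgClosed.exists_pow_nat_eq u (by norm_num : 0 < 2)
  refine ⟨z, ?_, by rw [hz, huw]⟩
  have h : ‖z‖ ^ 2 = 1 := by rw [← norm_pow, hz, hu]
  exact (pow_eq_one_iff_of_nonneg (norm_nonneg z) two_ne_zero).mp h

omit [DecidableEq n] in
/-- **The pointwise content of `w(T) = sup_θ ‖H_θ‖`**: for every vector `x` there is a unit scalar `z` with
`x^*H_zx = |x^*Tx|` (`H_z = ½(zT + (zT)^*)`; take `z·x^*Tx = |x^*Tx|`), hence `|x^*Tx| ≤ ‖H_z‖` for unit `x`.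
[cite: BhuniaBagPaul2019, § 1 («`w(T) = sup_{θ∈ℝ} ‖H_θ‖`») and Theorem 2.1 (proof)] -/
theorem exists_norm_quadForm_eq_quadForm_hermitianPart_smul (x : n → ℂ) :
    ∃ z : ℂ, ‖z‖ = 1 ∧
      star x ⬝ᵥ (((2 : ℂ)⁻¹ • (z • T + (z • T)ᴴ)) *ᵥ x) = ((‖star x ⬝ᵥ (T *ᵥ x)‖ : ℝ) : ℂ) := by
  obtain ⟨z, hz, hzw⟩ := exists_unit_mul_eq_norm (star x ⬝ᵥ (T *ᵥ x))
  refine ⟨z, hz, ?_⟩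
  rw [quadForm_hermitianPart, quadForm_smul, hzw, Complex.ofReal_re]

/-- **`|x^*Tx| ≤ ‖H_z‖` for a suitable unit scalar `z`** (unit `x`). [cite: BhuniaBagPaul2019, § 1 («`w(T) =
sup_{θ∈ℝ} ‖H_θ‖`»)] -/
theorem exists_norm_quadForm_le_norm_hermitianPart_smul {x : n → ℂ} (hx : star x ⬝ᵥ x = 1) :
    ∃ z : ℂ, ‖z‖ = 1 ∧ ‖star x ⬝ᵥ (T *ᵥ x)‖ ≤ ‖(2 : ℂ)⁻¹ • (z • T + (z • T)ᴴ)‖ := by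
  obtain ⟨z, hz, h⟩ := exists_norm_quadForm_eq_quadForm_hermitianPart_smul T x
  refine ⟨z, hz, ?_⟩
  have h1 := norm_quadForm_le_norm ((2 : ℂ)⁻¹ • (z • T + (z • T)ᴴ)) hx
  rwa [h, Complex.norm_real, Real.norm_of_nonneg (norm_nonneg _)] at h1

/-- `‖zX + (zX)^*‖ ≤ 2c` whenever `|y^*Xy| ≤ c` for all unit `y` and `|z| ≤ 1` (`‖2Re(zX)‖ ≤ 2w(X)`, the predecessor's
`norm_hermitianPart_smul_le` without the factor `½`). [cite: BhuniaBagPaul2019, § 1 («`w(T) = sup_{θ∈ℝ} ‖H_θ‖`»)] -/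
theorem norm_smul_add_conjTranspose_le (X : Matrix n n ℂ) {c : ℝ} (hc : 0 ≤ c)
    (h : ∀ y : n → ℂ, star y ⬝ᵥ y = 1 → ‖star y ⬝ᵥ (X *ᵥ y)‖ ≤ c) {z : ℂ} (hz : ‖z‖ ≤ 1) :
    ‖z • X + (z • X)ᴴ‖ ≤ 2 * c := by
  have h1 := norm_hermitianPart_smul_le X hc h hz
  rw [norm_smul, norm_inv, RCLike.norm_ofNat] at h1
  linarith

end Algebra

/-! ## § 2. Theorem 2.1: `w⁴(T) ≤ ¼w²(T²) + ⅛w(T²P + PT²) + (1/16)‖P‖²` -/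

section TheoremTwoOne

variable (T : Matrix n n ℂ)

/-- **Theorem 2.1 (Bhunia–Bag–Paul): `w⁴(T) ≤ ¼w²(T²) + ⅛w(T²P + PT²) + (1/16)‖P‖²`, `P = T^*T + TT^*`**, def-free:
if `|y^*T²y| ≤ a` and `|y^*(T²P + PT²)y| ≤ b` for all unit `y` (`a, b ≥ 0`), then
`|x^*Tx|⁴ ≤ ¼a² + ⅛b + (1/16)‖P‖²` for every unit `x`.  Road (as printed): `|x^*Tx| ≤ ‖H_z‖`, `‖H_z‖⁴ = ‖H_z⁴‖`,
`16H_z⁴ = (W + W^*)² + 2Re(z²(T²P + PT²)) + P²`, `‖W + W^*‖ = 2‖Re(z²T²)‖ ≤ 2a`, `‖2Re(z²(T²P + PT²))‖ ≤ 2b`.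
[cite: BhuniaBagPaul2019, Theorem 2.1] -/
theorem bhuniaBagPaul_thm_2_1 {a b : ℝ} (ha0 : 0 ≤ a) (hb0 : 0 ≤ b)
    (ha : ∀ y : n → ℂ, star y ⬝ᵥ y = 1 → ‖star y ⬝ᵥ ((T ^ 2) *ᵥ y)‖ ≤ a)
    (hb : ∀ y : n → ℂ, star y ⬝ᵥ y = 1 →
      ‖star y ⬝ᵥ ((T ^ 2 * (Tᴴ * T + T * Tᴴ) + (Tᴴ * T + T * Tᴴ) * T ^ 2) *ᵥ y)‖ ≤ b)
    {x : n → ℂ} (hx : star x ⬝ᵥ x = 1) :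
    ‖star x ⬝ᵥ (T *ᵥ x)‖ ^ 4 ≤ 1 / 4 * a ^ 2 + 1 / 8 * b + 1 / 16 * ‖Tᴴ * T + T * Tᴴ‖ ^ 2 := by
  obtain ⟨z, hz, hle⟩ := exists_norm_quadForm_le_norm_hermitianPart_smul T hx
  have hH : ((2 : ℂ)⁻¹ • (z • T + (z • T)ᴴ)).IsHermitian := isHermitian_hermitianPart_smul T z
  have hPh : (Tᴴ * T + T * Tᴴ).IsHermitian := by
    rw [IsHermitian, conjTranspose_add, conjTranspose_mul, conjTranspose_mul, conjTranspose_conjTranspose, add_comm]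
  have hz2 : ‖z ^ 2‖ ≤ 1 := by rw [norm_pow, hz, one_pow]
  have hW : ‖z ^ 2 • T ^ 2 + (z ^ 2 • T ^ 2)ᴴ‖ ≤ 2 * a := norm_smul_add_conjTranspose_le (T ^ 2) ha0 ha hz2
  have hV : ‖z ^ 2 • (T ^ 2 * (Tᴴ * T + T * Tᴴ) + (Tᴴ * T + T * Tᴴ) * T ^ 2) +
      (z ^ 2 • (T ^ 2 * (Tᴴ * T + T * Tᴴ) + (Tᴴ * T + T * Tᴴ) * T ^ 2))ᴴ‖ ≤ 2 * b :=
    norm_smul_add_conjTranspose_le _ hb0 hb hz2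
  have h16 := sixteen_smul_pow_four T hz
  have hn4 := norm_pow_four_of_isHermitian hH
  have hPP := norm_mul_self_of_isHermitian hPh
  -- generalize the atoms
  generalize (2 : ℂ)⁻¹ • (z • T + (z • T)ᴴ) = H at hle h16 hn4
  generalize z ^ 2 • T ^ 2 + (z ^ 2 • T ^ 2)ᴴ = W at hW h16
  generalize z ^ 2 • (T ^ 2 * (Tᴴ * T + T * Tᴴ) + (Tᴴ * T + T * Tᴴ) * T ^ 2) +
      (z ^ 2 • (T ^ 2 * (Tᴴ * T + T * Tᴴ) + (Tᴴ * T + T * Tᴴ) * T ^ 2))ᴴ = V at hV h16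
  generalize Tᴴ * T + T * Tᴴ = P at hPP h16 ⊢
  -- `16‖H‖⁴ = ‖W² + V + P²‖ ≤ 4a² + 2b + ‖P‖²`
  have hn := congrArg (fun X : Matrix n n ℂ => ‖X‖) h16
  simp only [norm_smul, RCLike.norm_ofNat] at hn
  rw [hn4] at hn
  have hWW : ‖W * W‖ ≤ (2 * a) * (2 * a) :=
    (l2_opNorm_mul _ _).trans (mul_le_mul hW hW (norm_nonneg _) (by linarith))
  have hbound : 16 * ‖H‖ ^ 4 ≤ 4 * a ^ 2 + 2 * b + ‖P‖ ^ 2 := by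
    rw [hn]
    calc ‖W * W + (V + P * P)‖ ≤ ‖W * W‖ + ‖V + P * P‖ := norm_add_le _ _
      _ ≤ ‖W * W‖ + (‖V‖ + ‖P * P‖) := by gcongr; exact norm_add_le _ _
      _ ≤ (2 * a) * (2 * a) + (2 * b + ‖P‖ ^ 2) := by rw [hPP]; linarith
      _ = 4 * a ^ 2 + 2 * b + ‖P‖ ^ 2 := by ring
  have hx4 : ‖star x ⬝ᵥ (T *ᵥ x)‖ ^ 4 ≤ ‖H‖ ^ 4 := pow_le_pow_left₀ (norm_nonneg _) hle 4
  linarith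

end TheoremTwoOne

/-! ## § 3. Theorem 2.3: `w³(T) ≤ ¼w(T³) + ¼w(T²T^* + T^*T² + TT^*T)` and the cases `T² = 0`, `T³ = 0` -/

section TheoremTwoThree

variable (T : Matrix n n ℂ)

/-- **Theorem 2.3 (Bhunia–Bag–Paul): `w³(T) ≤ ¼w(T³) + ¼w(T²T^* + T^*T² + TT^*T)`**, def-free: if `|y^*T³y| ≤ a` and
`|y^*(T²T^* + T^*T² + TT^*T)y| ≤ b` for all unit `y` (`a, b ≥ 0`), then `|x^*Tx|³ ≤ ¼a + ¼b` for every unit `x`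
(`|x^*Tx|³ ≤ ‖H_z‖³ = ‖H_z³‖`, `8H_z³ = 2Re(z³T³) + 2Re(zQ)`). [cite: BhuniaBagPaul2019, Theorem 2.3] -/
theorem bhuniaBagPaul_thm_2_3 {a b : ℝ} (ha0 : 0 ≤ a) (hb0 : 0 ≤ b)
    (ha : ∀ y : n → ℂ, star y ⬝ᵥ y = 1 → ‖star y ⬝ᵥ ((T ^ 3) *ᵥ y)‖ ≤ a)
    (hb : ∀ y : n → ℂ, star y ⬝ᵥ y = 1 → ‖star y ⬝ᵥ ((T ^ 2 * Tᴴ + Tᴴ * T ^ 2 + T * Tᴴ * T) *ᵥ y)‖ ≤ b)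
    {x : n → ℂ} (hx : star x ⬝ᵥ x = 1) :
    ‖star x ⬝ᵥ (T *ᵥ x)‖ ^ 3 ≤ 1 / 4 * a + 1 / 4 * b := by
  obtain ⟨z, hz, hle⟩ := exists_norm_quadForm_le_norm_hermitianPart_smul T hx
  have hH : ((2 : ℂ)⁻¹ • (z • T + (z • T)ᴴ)).IsHermitian := isHermitian_hermitianPart_smul T z
  have hz3 : ‖z ^ 3‖ ≤ 1 := by rw [norm_pow, hz, one_pow]
  have h3 : ‖z ^ 3 • T ^ 3 + (z ^ 3 • T ^ 3)ᴴ‖ ≤ 2 * a := norm_smul_add_conjTranspose_le (T ^ 3) ha0 ha hz3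
  have hQ : ‖z • (T ^ 2 * Tᴴ + Tᴴ * T ^ 2 + T * Tᴴ * T) + (z • (T ^ 2 * Tᴴ + Tᴴ * T ^ 2 + T * Tᴴ * T))ᴴ‖ ≤ 2 * b :=
    norm_smul_add_conjTranspose_le _ hb0 hb hz.le
  have h8 := hermitianPart_smul_pow_three T hz
  have hn3 := norm_pow_three_of_isHermitian hH
  generalize (2 : ℂ)⁻¹ • (z • T + (z • T)ᴴ) = H at hle h8 hn3
  have hn := congrArg (fun X : Matrix n n ℂ => ‖X‖) h8
  simp only [norm_smul, RCLike.norm_ofNat] at hn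
  rw [hn3] at hn
  have hbound : 8 * ‖H‖ ^ 3 ≤ 2 * a + 2 * b := by
    rw [hn]
    exact (norm_add_le _ _).trans (add_le_add h3 hQ)
  have hx3 : ‖star x ⬝ᵥ (T *ᵥ x)‖ ^ 3 ≤ ‖H‖ ^ 3 := pow_le_pow_left₀ (norm_nonneg _) hle 3
  linarith

/-- For `T² = 0` every rotated real part has `4H_z² = P = T^*T + TT^*`, hence `‖H_z‖² = ¼‖P‖` («If `T² = 0` then
`4H_θ² = T^*T + TT^*`»). [cite: BhuniaBagPaul2019, Theorem 2.3 (proof)] -/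
theorem norm_hermitianPart_smul_sq_of_sq_eq_zero (hT : T ^ 2 = 0) {z : ℂ} (hz : ‖z‖ = 1) :
    ‖(2 : ℂ)⁻¹ • (z • T + (z • T)ᴴ)‖ ^ 2 = 1 / 4 * ‖Tᴴ * T + T * Tᴴ‖ := by
  have h4 := hermitianPart_smul_mul_self T hz
  rw [hT, smul_zero, conjTranspose_zero, add_zero, zero_add] at h4
  have hn2 := norm_mul_self_of_isHermitian (isHermitian_hermitianPart_smul T z)
  have h := congrArg (fun M : Matrix n n ℂ => ‖M‖) h4
  simp only [norm_smul, RCLike.norm_ofNat] at h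
  rw [hn2] at h
  linarith

/-- **Theorem 2.3, the case `T² = 0`: `w(T) = ½√‖TT^* + T^*T‖`** (`n ≥ 1`), def-free and attained: `½√‖P‖` is the
greatest value of `|x^*Tx|` over unit vectors (`|x^*Tx| ≤ ‖H_z‖ = ½√‖P‖`; the maximum `M` of `|x^*Tx|` has
`‖H_1‖ ≤ M`).  Compare the predecessor's `isGreatest_quadForm_of_sq_eq_zero` (`= ½‖T‖`, Kittaneh 2003): for `T² = 0`
indeed `‖T^*T + TT^*‖ = ‖T‖²`. [cite: BhuniaBagPaul2019, Theorem 2.3 («if `T² = 0` then `w(T) = ½√‖TT^* + T^*T‖`»)] -/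
theorem isGreatest_quadForm_of_sq_eq_zero' [Nonempty n] (hT : T ^ 2 = 0) :
    IsGreatest {r : ℝ | ∃ x : n → ℂ, star x ⬝ᵥ x = 1 ∧ ‖star x ⬝ᵥ (T *ᵥ x)‖ = r}
      (1 / 2 * Real.sqrt ‖Tᴴ * T + T * Tᴴ‖) := by
  have hval : ∀ {z : ℂ}, ‖z‖ = 1 → ‖(2 : ℂ)⁻¹ • (z • T + (z • T)ᴴ)‖ = 1 / 2 * Real.sqrt ‖Tᴴ * T + T * Tᴴ‖ := by
    intro z hz
    have h := norm_hermitianPart_smul_sq_of_sq_eq_zero T hT hz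
    have h2 : (1 / 2 * Real.sqrt ‖Tᴴ * T + T * Tᴴ‖) ^ 2 = 1 / 4 * ‖Tᴴ * T + T * Tᴴ‖ := by
      rw [mul_pow, Real.sq_sqrt (norm_nonneg _)]; ring
    exact (pow_left_inj₀ (norm_nonneg _) (by positivity) two_ne_zero).mp (h.trans h2.symm)
  have hup : ∀ x : n → ℂ, star x ⬝ᵥ x = 1 → ‖star x ⬝ᵥ (T *ᵥ x)‖ ≤ 1 / 2 * Real.sqrt ‖Tᴴ * T + T * Tᴴ‖ := by
    intro x hx
    obtain ⟨z, hz, hle⟩ := exists_norm_quadForm_le_norm_hermitianPart_smul T hx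
    exact hle.trans_eq (hval hz)
  obtain ⟨x₀, hx₀, hmax⟩ := exists_max_quadForm T
  have hM := norm_hermitianPart_smul_le T (norm_nonneg _) hmax (z := 1) (by rw [norm_one])
  rw [hval norm_one] at hM
  refine ⟨⟨x₀, hx₀, le_antisymm (hup x₀ hx₀) hM⟩, ?_⟩
  rintro r ⟨x, hx, rfl⟩
  exact hup x hx

/-- **Theorem 2.3, the case `T³ = 0`: `w³(T) = ¼w(T²T^* + T^*T² + TT^*T)`**, def-free: if `M = w(T)` and `M' = w(Q)` are
the (attained) numerical radii of `T` and of `Q = T²T^* + T^*T² + TT^*T`, then `M³ = ¼M'` (`≤` by Theorem 2.3 with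
`w(T³) = 0`; `≥` since `H_z³ = ¼Re(zQ)` gives `¼‖Re(zQ)‖ = ‖H_z‖³ ≤ M³` for every unit `z`, and
`w(Q) = sup_z ‖Re(zQ)‖`). [cite: BhuniaBagPaul2019, Theorem 2.3 («if `T³ = 0` then `w(T) = (¼w(T²T^* + T^*T² + TT^*T))^{1/3}`»)] -/
theorem numericalRadius_pow_three_of_pow_three_eq_zero (hT : T ^ 3 = 0) {M M' : ℝ}
    (hM : IsGreatest {r : ℝ | ∃ x : n → ℂ, star x ⬝ᵥ x = 1 ∧ ‖star x ⬝ᵥ (T *ᵥ x)‖ = r} M)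
    (hM' : IsGreatest {r : ℝ | ∃ x : n → ℂ, star x ⬝ᵥ x = 1 ∧
      ‖star x ⬝ᵥ ((T ^ 2 * Tᴴ + Tᴴ * T ^ 2 + T * Tᴴ * T) *ᵥ x)‖ = r} M') :
    M ^ 3 = 1 / 4 * M' := by
  obtain ⟨⟨x₀, hx₀, hx₀M⟩, hMub⟩ := hM
  obtain ⟨⟨y₀, hy₀, hy₀M'⟩, hM'ub⟩ := hM'
  have hM0 : 0 ≤ M := hx₀M ▸ norm_nonneg _
  have hM'0 : 0 ≤ M' := hy₀M' ▸ norm_nonneg _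
  have hwT : ∀ x : n → ℂ, star x ⬝ᵥ x = 1 → ‖star x ⬝ᵥ (T *ᵥ x)‖ ≤ M := fun x hx => hMub ⟨x, hx, rfl⟩
  have hwQ : ∀ x : n → ℂ, star x ⬝ᵥ x = 1 →
      ‖star x ⬝ᵥ ((T ^ 2 * Tᴴ + Tᴴ * T ^ 2 + T * Tᴴ * T) *ᵥ x)‖ ≤ M' := fun x hx => hM'ub ⟨x, hx, rfl⟩
  refine le_antisymm ?_ ?_
  · -- `M³ = |x₀^*Tx₀|³ ≤ ¼·0 + ¼M'`
    have h := bhuniaBagPaul_thm_2_3 T le_rfl hM'0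
      (fun y _ => by rw [hT, zero_mulVec, dotProduct_zero, norm_zero]) hwQ hx₀
    rw [hx₀M] at h
    linarith
  · -- `¼‖Re(zQ)‖ = ‖H_z‖³ ≤ M³` for every unit `z`, hence `M' ≤ 4M³`
    have hRe : ∀ z : ℂ, ‖z‖ = 1 →
        ‖(2 : ℂ)⁻¹ • (z • (T ^ 2 * Tᴴ + Tᴴ * T ^ 2 + T * Tᴴ * T) +
          (z • (T ^ 2 * Tᴴ + Tᴴ * T ^ 2 + T * Tᴴ * T))ᴴ)‖ ≤ 4 * M ^ 3 := by
      intro z hz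
      have h8 := hermitianPart_smul_pow_three T hz
      rw [hT, smul_zero, conjTranspose_zero, add_zero, zero_add] at h8
      have hn3 := norm_pow_three_of_isHermitian (isHermitian_hermitianPart_smul T z)
      have hHM : ‖(2 : ℂ)⁻¹ • (z • T + (z • T)ᴴ)‖ ≤ M := norm_hermitianPart_smul_le T hM0 hwT hz.le
      have hn := congrArg (fun X : Matrix n n ℂ => ‖X‖) h8
      simp only [norm_smul, RCLike.norm_ofNat] at hn
      rw [hn3] at hn
      have h1 := pow_le_pow_left₀ (norm_nonneg _) hHM 3
      rw [norm_smul, norm_inv, RCLike.norm_ofNat, ← hn]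
      linarith
    have hQ4 := norm_quadForm_le_of_forall_norm_hermitianPart_smul_le _ hRe hy₀
    rw [hy₀M'] at hQ4
    linarith

end TheoremTwoThree

/-! ## § 4. Theorem 2.5: `w^{2r}(T) ≤ ½wʳ(T²) + ¼‖(T^*T)ʳ + (TT^*)ʳ‖` (`r ≥ 1`) -/

section TheoremTwoFive

variable (T : Matrix n n ℂ)

/-- `‖H_z²‖ ≤ ½‖Re(z²T²)‖ + ¼‖T^*T + TT^*‖` («`H_θ² = ½Re(e^{2iθ}T²) + ¼(T^*T + TT^*) ⇒ ‖H_θ²‖ ≤ …`»).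
[cite: BhuniaBagPaul2019, Theorem 2.5 (proof)] -/
theorem norm_hermitianPart_smul_sq_le {z : ℂ} (hz : ‖z‖ = 1) :
    ‖((2 : ℂ)⁻¹ • (z • T + (z • T)ᴴ)) * ((2 : ℂ)⁻¹ • (z • T + (z • T)ᴴ))‖ ≤
      1 / 2 * ‖(2 : ℂ)⁻¹ • (z ^ 2 • T ^ 2 + (z ^ 2 • T ^ 2)ᴴ)‖ + 1 / 4 * ‖Tᴴ * T + T * Tᴴ‖ := by
  have h4 := hermitianPart_smul_mul_self T hz
  have hn := congrArg (fun X : Matrix n n ℂ => ‖X‖) h4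
  simp only [norm_smul, RCLike.norm_ofNat] at hn
  have h := norm_add_le (z ^ 2 • T ^ 2 + (z ^ 2 • T ^ 2)ᴴ) (Tᴴ * T + T * Tᴴ)
  rw [← hn] at h
  rw [norm_smul, norm_inv, RCLike.norm_ofNat]
  linarith

/-- `0 ≤ ½` in the star order of `ℂ`. [folklore] -/
private theorem half_nonneg : (0 : ℂ) ≤ (2⁻¹ : ℂ) := by
  rw [show (2⁻¹ : ℂ) = ((2⁻¹ : ℝ) : ℂ) by norm_num]
  exact Complex.zero_le_real.mpr (by norm_num)

/-- **Operator concavity of `t^{1/r}` read as a norm inequality: `‖½A + ½B‖ʳ ≤ ‖½Aʳ + ½Bʳ‖`** for `A, B ⪰ 0`, `r ≥ 1`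
(`½A + ½B = ½(Aʳ)^{1/r} + ½(Bʳ)^{1/r} ≤ (½Aʳ + ½Bʳ)^{1/r}` by the tree's `half_smul_rpow_add_half_smul_rpow_le`, the norm is
monotone on the positive cone, and `‖X^{1/r}‖ = ‖X‖^{1/r}` — Mathlib `CFC.norm_rpow`). [cite: BhuniaBagPaul2019,
Theorem 2.5 (proof: «`t^{1/r}` … concave operator function … `‖(T^*T + TT^*)/2‖ʳ ≤ ‖(((T^*T)ʳ + (TT^*)ʳ)/2)^{1/r}‖ʳ =
‖((T^*T)ʳ + (TT^*)ʳ)/2‖`»)] -/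
theorem norm_half_add_half_rpow_le {A B : Matrix n n ℂ} (hA : A.PosSemidef) (hB : B.PosSemidef) {r : ℝ} (hr : 1 ≤ r) :
    ‖(2⁻¹ : ℂ) • A + (2⁻¹ : ℂ) • B‖ ^ r ≤ ‖(2⁻¹ : ℂ) • A ^ r + (2⁻¹ : ℂ) • B ^ r‖ := by
  letI : CStarAlgebra (Matrix n n ℂ) := {}
  have hr0 : 0 < r := lt_of_lt_of_le one_pos hr
  have hAr : (A ^ r).PosSemidef := posSemidef_rpow A r
  have hBr : (B ^ r).PosSemidef := posSemidef_rpow B r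
  -- `½A + ½B ≤ (½Aʳ + ½Bʳ)^{1/r}`
  have hconc := half_smul_rpow_add_half_smul_rpow_le hAr hBr (r := 1 / r) (by positivity)
    ((div_le_one hr0).mpr hr)
  rw [rpow_rpow_of_nonneg hA hr0.le (by positivity), rpow_rpow_of_nonneg hB hr0.le (by positivity),
    mul_one_div_cancel hr0.ne', rpow_one hA, rpow_one hB] at hconc
  have hX : ((2⁻¹ : ℂ) • A + (2⁻¹ : ℂ) • B).PosSemidef := (hA.smul half_nonneg).add (hB.smul half_nonneg)
  have hM : ((2⁻¹ : ℂ) • A ^ r + (2⁻¹ : ℂ) • B ^ r).PosSemidef := (hAr.smul half_nonneg).add (hBr.smul half_nonneg)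
  -- norms: `‖½A + ½B‖ ≤ ‖M^{1/r}‖ = ‖M‖^{1/r}`
  have hnorm : ‖(2⁻¹ : ℂ) • A + (2⁻¹ : ℂ) • B‖ ≤ ‖(2⁻¹ : ℂ) • A ^ r + (2⁻¹ : ℂ) • B ^ r‖ ^ (1 / r) := by
    have h := CStarAlgebra.norm_le_norm_of_nonneg_of_le hX.nonneg hconc
    rwa [CFC.norm_rpow _ (by positivity) hM.nonneg] at h
  calc ‖(2⁻¹ : ℂ) • A + (2⁻¹ : ℂ) • B‖ ^ r ≤ (‖(2⁻¹ : ℂ) • A ^ r + (2⁻¹ : ℂ) • B ^ r‖ ^ (1 / r)) ^ r :=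
        Real.rpow_le_rpow (norm_nonneg _) hnorm hr0.le
    _ = ‖(2⁻¹ : ℂ) • A ^ r + (2⁻¹ : ℂ) • B ^ r‖ := by
        rw [← Real.rpow_mul (norm_nonneg _), one_div_mul_cancel hr0.ne', Real.rpow_one]

/-- **Theorem 2.5 (Bhunia–Bag–Paul): `w^{2r}(T) ≤ ½wʳ(T²) + ¼‖(T^*T)ʳ + (TT^*)ʳ‖` for `r ≥ 1`**, def-free: if
`|y^*T²y| ≤ a` for all unit `y` (`a ≥ 0`), then `|x^*Tx|^{2r} ≤ ½aʳ + ¼‖(T^*T)ʳ + (TT^*)ʳ‖` for every unit `x`.  Road (as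
printed): `|x^*Tx|² ≤ ‖H_z²‖ ≤ ½‖Re(z²T²)‖ + ½‖P/2‖`, scalar convexity of `tʳ`, then `‖P/2‖ʳ ≤ ‖((T^*T)ʳ + (TT^*)ʳ)/2‖`
(operator concavity of `t^{1/r}`). [cite: BhuniaBagPaul2019, Theorem 2.5] -/
theorem bhuniaBagPaul_thm_2_5 {a : ℝ} (ha0 : 0 ≤ a)
    (ha : ∀ y : n → ℂ, star y ⬝ᵥ y = 1 → ‖star y ⬝ᵥ ((T ^ 2) *ᵥ y)‖ ≤ a) {r : ℝ} (hr : 1 ≤ r)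
    {x : n → ℂ} (hx : star x ⬝ᵥ x = 1) :
    ‖star x ⬝ᵥ (T *ᵥ x)‖ ^ (2 * r) ≤ 1 / 2 * a ^ r + 1 / 4 * ‖(Tᴴ * T) ^ r + (T * Tᴴ) ^ r‖ := by
  have hr0 : 0 < r := lt_of_lt_of_le one_pos hr
  obtain ⟨z, hz, hle⟩ := exists_norm_quadForm_le_norm_hermitianPart_smul T hx
  have hH : ((2 : ℂ)⁻¹ • (z • T + (z • T)ᴴ)).IsHermitian := isHermitian_hermitianPart_smul T z
  have hz2 : ‖z ^ 2‖ ≤ 1 := by rw [norm_pow, hz, one_pow]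
  have hp : ‖(2⁻¹ : ℂ) • (Tᴴ * T) + (2⁻¹ : ℂ) • (T * Tᴴ)‖ = 1 / 2 * ‖Tᴴ * T + T * Tᴴ‖ := by
    rw [← smul_add, norm_smul, norm_inv, RCLike.norm_ofNat]; ring
  have hR : ‖(2 : ℂ)⁻¹ • (z ^ 2 • T ^ 2 + (z ^ 2 • T ^ 2)ᴴ)‖ ≤ a := norm_hermitianPart_smul_le (T ^ 2) ha0 ha hz2
  have h1 : ‖star x ⬝ᵥ (T *ᵥ x)‖ ^ 2 ≤
      ‖((2 : ℂ)⁻¹ • (z • T + (z • T)ᴴ)) * ((2 : ℂ)⁻¹ • (z • T + (z • T)ᴴ))‖ := by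
    rw [norm_mul_self_of_isHermitian hH]; exact pow_le_pow_left₀ (norm_nonneg _) hle 2
  have h2 := norm_hermitianPart_smul_sq_le T hz
  -- `s = |x^*Tx|² ≤ ½a + ½p`, `p = ‖P/2‖`
  have hs : ‖star x ⬝ᵥ (T *ᵥ x)‖ ^ 2 ≤ 1 / 2 * a + 1 / 2 * ‖(2⁻¹ : ℂ) • (Tᴴ * T) + (2⁻¹ : ℂ) • (T * Tᴴ)‖ := by
    rw [hp]; linarith
  have hs0 : 0 ≤ ‖star x ⬝ᵥ (T *ᵥ x)‖ ^ 2 := by positivity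
  have hp0 : 0 ≤ ‖(2⁻¹ : ℂ) • (Tᴴ * T) + (2⁻¹ : ℂ) • (T * Tᴴ)‖ := norm_nonneg _
  -- scalar convexity of `t ↦ tʳ`
  have hconv : (1 / 2 * a + 1 / 2 * ‖(2⁻¹ : ℂ) • (Tᴴ * T) + (2⁻¹ : ℂ) • (T * Tᴴ)‖) ^ r ≤
      1 / 2 * a ^ r + 1 / 2 * ‖(2⁻¹ : ℂ) • (Tᴴ * T) + (2⁻¹ : ℂ) • (T * Tᴴ)‖ ^ r := by
    have h := (convexOn_rpow hr).2 (Set.mem_Ici.mpr ha0) (Set.mem_Ici.mpr hp0) (by norm_num : (0 : ℝ) ≤ 1 / 2)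
      (by norm_num : (0 : ℝ) ≤ 1 / 2) (by norm_num)
    simpa only [smul_eq_mul] using h
  -- operator concavity of `t ↦ t^{1/r}`
  have hop : ‖(2⁻¹ : ℂ) • (Tᴴ * T) + (2⁻¹ : ℂ) • (T * Tᴴ)‖ ^ r ≤ 1 / 2 * ‖(Tᴴ * T) ^ r + (T * Tᴴ) ^ r‖ := by
    have h := norm_half_add_half_rpow_le (posSemidef_conjTranspose_mul_self T) (posSemidef_self_mul_conjTranspose T) hr
    have e : ‖(2⁻¹ : ℂ) • (Tᴴ * T) ^ r + (2⁻¹ : ℂ) • (T * Tᴴ) ^ r‖ = 1 / 2 * ‖(Tᴴ * T) ^ r + (T * Tᴴ) ^ r‖ := by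
      rw [← smul_add, norm_smul, norm_inv, RCLike.norm_ofNat]; ring
    rwa [e] at h
  calc ‖star x ⬝ᵥ (T *ᵥ x)‖ ^ (2 * r) = (‖star x ⬝ᵥ (T *ᵥ x)‖ ^ 2) ^ r := by
        rw [Real.rpow_mul (norm_nonneg _), Real.rpow_two]
    _ ≤ (1 / 2 * a + 1 / 2 * ‖(2⁻¹ : ℂ) • (Tᴴ * T) + (2⁻¹ : ℂ) • (T * Tᴴ)‖) ^ r :=
        Real.rpow_le_rpow hs0 hs hr0.le
    _ ≤ 1 / 2 * a ^ r + 1 / 2 * ‖(2⁻¹ : ℂ) • (Tᴴ * T) + (2⁻¹ : ℂ) • (T * Tᴴ)‖ ^ r := hconv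
    _ ≤ 1 / 2 * a ^ r + 1 / 4 * ‖(Tᴴ * T) ^ r + (T * Tᴴ) ^ r‖ := by linarith

end TheoremTwoFive

/-! ## § 5. Theorem 2.7: `w(T) ≤ (‖H_φ‖² + ‖H_{φ+π/2}‖²)^{1/2}` -/

section TheoremTwoSeven

variable (T : Matrix n n ℂ)

/-- **Theorem 2.7 (Bhunia–Bag–Paul): `w(T) ≤ inf_φ √(‖H_φ‖² + ‖H_{φ+π/2}‖²)`**, def-free, for every unit scalar `z`
(`e^{iφ} = z`, `e^{i(φ+π/2)} = iz`): `|x^*Tx|² ≤ ‖½(zT + (zT)^*)‖² + ‖½(izT + (izT)^*)‖²` for every unit `x`.  Road: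
`|x^*Tx|² = |x^*(zT)x|² = Re(x^*(zT)x)² + Im(x^*(zT)x)²`, `Re(x^*(zT)x) = x^*Re(zT)x`, `Im(x^*(zT)x) = −x^*Re(izT)x`
(the printed proof: `H_{θ+φ} = H_φ cos θ + H_{φ+π/2} sin θ`).  For `z = 1` (`φ = 0`) this is Remark 2.8
`w(T) ≤ √(‖Re T‖² + ‖Im T‖²)`, the predecessor's `norm_sq_quadForm_le_norm_sq_add_norm_sq`.
[cite: BhuniaBagPaul2019, Theorem 2.7 and Remark 2.8] -/
theorem bhuniaBagPaul_thm_2_7 {z : ℂ} (hz : ‖z‖ = 1) {x : n → ℂ} (hx : star x ⬝ᵥ x = 1) :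
    ‖star x ⬝ᵥ (T *ᵥ x)‖ ^ 2 ≤
      ‖(2 : ℂ)⁻¹ • (z • T + (z • T)ᴴ)‖ ^ 2 + ‖(2 : ℂ)⁻¹ • ((Complex.I * z) • T + ((Complex.I * z) • T)ᴴ)‖ ^ 2 := by
  set w := star x ⬝ᵥ ((z • T) *ᵥ x) with hw_def
  have hw : ‖star x ⬝ᵥ (T *ᵥ x)‖ = ‖w‖ := by rw [hw_def, quadForm_smul, norm_mul, hz, one_mul]
  have hre : ‖star x ⬝ᵥ (((2 : ℂ)⁻¹ • (z • T + (z • T)ᴴ)) *ᵥ x)‖ = |w.re| := norm_quadForm_hermitianPart (z • T) x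
  have him : ‖star x ⬝ᵥ (((2 : ℂ)⁻¹ • ((Complex.I * z) • T + ((Complex.I * z) • T)ᴴ)) *ᵥ x)‖ = |w.im| := by
    rw [norm_quadForm_hermitianPart, quadForm_smul, mul_assoc, ← quadForm_smul, ← hw_def, Complex.I_mul_re, abs_neg]
  have h1 : |w.re| ≤ ‖(2 : ℂ)⁻¹ • (z • T + (z • T)ᴴ)‖ := by
    rw [← hre]; exact norm_quadForm_le_norm _ hx
  have h2 : |w.im| ≤ ‖(2 : ℂ)⁻¹ • ((Complex.I * z) • T + ((Complex.I * z) • T)ᴴ)‖ := by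
    rw [← him]; exact norm_quadForm_le_norm _ hx
  have hsq : ‖w‖ ^ 2 = |w.re| ^ 2 + |w.im| ^ 2 := by
    rw [sq_abs, sq_abs, Complex.sq_norm, Complex.normSq_apply]; ring
  rw [hw, hsq]
  exact add_le_add (pow_le_pow_left₀ (abs_nonneg _) h1 2) (pow_le_pow_left₀ (abs_nonneg _) h2 2)

end TheoremTwoSeven

/-! ## § 6. Theorem 3.1: `w⁴(T) ≥ ¼C²(T²) + ⅛m(T²P + PT²) + (1/16)‖P‖²` -/

section TheoremThreeOne

variable (T : Matrix n n ℂ)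

/-- A nonnegative complex number (in the star order) is its real part: `‖w‖ = Re w`. [folklore] -/
private theorem norm_eq_re_of_nonneg {w : ℂ} (h : 0 ≤ w) : ‖w‖ = w.re := by
  obtain ⟨hre, him⟩ := Complex.nonneg_iff.mp h
  have hw : w = ((w.re : ℝ) : ℂ) := Complex.ext (by simp) (by simp [← him])
  rw [hw, Complex.norm_real, Real.norm_of_nonneg (by simpa using hre), Complex.ofReal_re]

omit [DecidableEq n] in
/-- `Re(x^*X²x) = ‖Xx‖²` for a Hermitian `X` (`x^*X²x = (Xx)^*(Xx)`), in the `dotProduct` spelling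
`re(star (X *ᵥ x) ⬝ᵥ (X *ᵥ x))`. [folklore] -/
private theorem re_quadForm_mul_self_of_isHermitian {X : Matrix n n ℂ} (hX : X.IsHermitian) (x : n → ℂ) :
    (star x ⬝ᵥ ((X * X) *ᵥ x)).re = (star (X *ᵥ x) ⬝ᵥ (X *ᵥ x)).re := by
  rw [← mulVec_mulVec, dotProduct_mulVec, star_mulVec, hX.eq]

/-- `Re(4·w) = 4·Re w`. [folklore] -/
private theorem re_four_mul (w : ℂ) : ((4 : ℂ) * w).re = 4 * w.re := by
  rw [show (4 : ℂ) = ((4 : ℝ) : ℂ) by norm_num, Complex.re_ofReal_mul]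

/-- **Theorem 3.1, pointwise step**: if `w(T) ≤ c`, `‖Re(uT²)y‖² ≥ c₁²` and `|y^*(T²P + PT²)y| ≥ m₁` for all unit `y`
and unit scalars `u`, then for every unit `x`: `4c₁² + 2m₁ + ‖Px‖² ≤ 16c⁴` (`‖Px‖²` spelled `re((Px)^*(Px))`).  Road
(as printed): choose `z` with `z²·x^*(T²P + PT²)x = |x^*(T²P + PT²)x|`; then `16c⁴ ≥ ‖16H_z⁴‖ ≥ Re(x^*16H_z⁴x) =
4‖Re(z²T²)x‖² + 2|x^*(T²P + PT²)x| + ‖Px‖²`. [cite: BhuniaBagPaul2019, Theorem 3.1 (proof)] -/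
theorem bhuniaBagPaul_thm_3_1_pointwise {c c₁ m₁ : ℝ} (hc : 0 ≤ c)
    (hw : ∀ y : n → ℂ, star y ⬝ᵥ y = 1 → ‖star y ⬝ᵥ (T *ᵥ y)‖ ≤ c)
    (hC : ∀ (y : n → ℂ) (u : ℂ), star y ⬝ᵥ y = 1 → ‖u‖ = 1 →
      c₁ ^ 2 ≤ (star ((((2 : ℂ)⁻¹ • (u • T ^ 2 + (u • T ^ 2)ᴴ))) *ᵥ y) ⬝ᵥ
        ((((2 : ℂ)⁻¹ • (u • T ^ 2 + (u • T ^ 2)ᴴ))) *ᵥ y)).re)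
    (hm : ∀ y : n → ℂ, star y ⬝ᵥ y = 1 →
      m₁ ≤ ‖star y ⬝ᵥ ((T ^ 2 * (Tᴴ * T + T * Tᴴ) + (Tᴴ * T + T * Tᴴ) * T ^ 2) *ᵥ y)‖)
    {x : n → ℂ} (hx : star x ⬝ᵥ x = 1) :
    4 * c₁ ^ 2 + 2 * m₁ + (star ((Tᴴ * T + T * Tᴴ) *ᵥ x) ⬝ᵥ ((Tᴴ * T + T * Tᴴ) *ᵥ x)).re ≤ 16 * c ^ 4 := by
  obtain ⟨z, hz, hzV⟩ := exists_unit_sq_mul_eq_norm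
    (star x ⬝ᵥ ((T ^ 2 * (Tᴴ * T + T * Tᴴ) + (Tᴴ * T + T * Tᴴ) * T ^ 2) *ᵥ x))
  have hH : ((2 : ℂ)⁻¹ • (z • T + (z • T)ᴴ)).IsHermitian := isHermitian_hermitianPart_smul T z
  have hRh : ((2 : ℂ)⁻¹ • (z ^ 2 • T ^ 2 + (z ^ 2 • T ^ 2)ᴴ)).IsHermitian :=
    isHermitian_hermitianPart_smul (T ^ 2) (z ^ 2)
  have hPh : (Tᴴ * T + T * Tᴴ).IsHermitian := by
    rw [IsHermitian, conjTranspose_add, conjTranspose_mul, conjTranspose_mul, conjTranspose_conjTranspose, add_comm]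
  have hz2 : ‖z ^ 2‖ = 1 := by rw [norm_pow, hz, one_pow]
  -- the three lower bounds, before generalizing
  have h1 : c₁ ^ 2 ≤ (star (((2 : ℂ)⁻¹ • (z ^ 2 • T ^ 2 + (z ^ 2 • T ^ 2)ᴴ)) *ᵥ x) ⬝ᵥ
      (((2 : ℂ)⁻¹ • (z ^ 2 • T ^ 2 + (z ^ 2 • T ^ 2)ᴴ)) *ᵥ x)).re := hC x (z ^ 2) hx hz2
  have h2 := hm x hx
  -- `‖16H⁴‖ ≤ 16c⁴`
  have hHc : ‖(2 : ℂ)⁻¹ • (z • T + (z • T)ᴴ)‖ ≤ c := norm_hermitianPart_smul_le T hc hw hz.le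
  have hn4 := norm_pow_four_of_isHermitian hH
  have h16 := sixteen_smul_pow_four T hz
  -- the middle term: `x^*(z²V + (z²V)^*)x = 2|x^*Vx|`
  have hmid : (star x ⬝ᵥ ((z ^ 2 • (T ^ 2 * (Tᴴ * T + T * Tᴴ) + (Tᴴ * T + T * Tᴴ) * T ^ 2) +
      (z ^ 2 • (T ^ 2 * (Tᴴ * T + T * Tᴴ) + (Tᴴ * T + T * Tᴴ) * T ^ 2))ᴴ) *ᵥ x)).re =
        2 * ‖star x ⬝ᵥ ((T ^ 2 * (Tᴴ * T + T * Tᴴ) + (Tᴴ * T + T * Tᴴ) * T ^ 2) *ᵥ x)‖ := by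
    rw [add_mulVec, dotProduct_add, ← conj_quadForm', quadForm_smul, hzV, Complex.add_re, Complex.conj_re,
      Complex.ofReal_re]
    ring
  -- `W + W^* = 2R`; generalize the atoms `R`, `H`, `V`, `P`
  have hWW : z ^ 2 • T ^ 2 + (z ^ 2 • T ^ 2)ᴴ = (2 : ℂ) • ((2 : ℂ)⁻¹ • (z ^ 2 • T ^ 2 + (z ^ 2 • T ^ 2)ᴴ)) := by
    rw [smul_smul, mul_inv_cancel₀ two_ne_zero, one_smul]
  generalize (2 : ℂ)⁻¹ • (z ^ 2 • T ^ 2 + (z ^ 2 • T ^ 2)ᴴ) = R at h1 hRh hWW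
  generalize (2 : ℂ)⁻¹ • (z • T + (z • T)ᴴ) = H at hH hHc hn4 h16
  generalize z ^ 2 • (T ^ 2 * (Tᴴ * T + T * Tᴴ) + (Tᴴ * T + T * Tᴴ) * T ^ 2) +
      (z ^ 2 • (T ^ 2 * (Tᴴ * T + T * Tᴴ) + (Tᴴ * T + T * Tᴴ) * T ^ 2))ᴴ = V at hmid h16
  generalize Tᴴ * T + T * Tᴴ = P at hPh h16 hmid h2 ⊢
  rw [hWW] at h16
  have hRR : (star x ⬝ᵥ ((((2 : ℂ) • R) * ((2 : ℂ) • R)) *ᵥ x)).re = 4 * (star (R *ᵥ x) ⬝ᵥ (R *ᵥ x)).re := by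
    rw [smul_mul_smul_comm, show ((2 : ℂ) * 2) = 4 by norm_num, quadForm_smul, re_four_mul,
      re_quadForm_mul_self_of_isHermitian hRh]
  have hPP : (star x ⬝ᵥ ((P * P) *ᵥ x)).re = (star (P *ᵥ x) ⬝ᵥ (P *ᵥ x)).re :=
    re_quadForm_mul_self_of_isHermitian hPh x
  -- assemble: `Re(x^*16H⁴x) ≤ ‖16H⁴‖ ≤ 16c⁴`
  have h3 : (star x ⬝ᵥ (((16 : ℂ) • (H * H * (H * H))) *ᵥ x)).re ≤ 16 * c ^ 4 := by
    refine (re_quadForm_le_norm _ hx).trans ?_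
    rw [norm_smul, RCLike.norm_ofNat, hn4]
    have := pow_le_pow_left₀ (norm_nonneg _) hHc 4
    linarith
  rw [h16, add_mulVec, add_mulVec, dotProduct_add, dotProduct_add, Complex.add_re, Complex.add_re, hRR, hmid, hPP] at h3
  linarith

/-- **Theorem 3.1 (Bhunia–Bag–Paul): `w⁴(T) ≥ ¼C²(T²) + ⅛m(T²P + PT²) + (1/16)‖P‖²`** (`n ≥ 1`), def-free: if `w(T) ≤ c`,
`C²(T²) ≥ c₁²` (i.e. `‖Re(uT²)y‖² ≥ c₁²` for all unit `y`, `u`) and `m(T²P + PT²) ≥ m₁`, then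
`¼c₁² + ⅛m₁ + (1/16)‖P‖² ≤ c⁴`.  From the pointwise step and «`sup_{‖x‖=1} ‖Px‖² = ‖P‖²`» (here: `‖P²‖ = ‖P‖²` is the
numerical radius of the normal matrix `P²`, the predecessor's `norm_le_of_isStarNormal_of_forall_quadForm_le`).
Remark 3.2: with `c₁ = m₁ = 0` this is Kittaneh's `¼‖P‖ ≤ w²(T)` (the predecessor's `kittaneh2005_quarter_norm_le_sq`).
[cite: BhuniaBagPaul2019, Theorem 3.1 and Remark 3.2] -/
theorem bhuniaBagPaul_thm_3_1 [Nonempty n] {c c₁ m₁ : ℝ} (hc : 0 ≤ c)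
    (hw : ∀ y : n → ℂ, star y ⬝ᵥ y = 1 → ‖star y ⬝ᵥ (T *ᵥ y)‖ ≤ c)
    (hC : ∀ (y : n → ℂ) (u : ℂ), star y ⬝ᵥ y = 1 → ‖u‖ = 1 →
      c₁ ^ 2 ≤ (star ((((2 : ℂ)⁻¹ • (u • T ^ 2 + (u • T ^ 2)ᴴ))) *ᵥ y) ⬝ᵥ
        ((((2 : ℂ)⁻¹ • (u • T ^ 2 + (u • T ^ 2)ᴴ))) *ᵥ y)).re)
    (hm : ∀ y : n → ℂ, star y ⬝ᵥ y = 1 →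
      m₁ ≤ ‖star y ⬝ᵥ ((T ^ 2 * (Tᴴ * T + T * Tᴴ) + (Tᴴ * T + T * Tᴴ) * T ^ 2) *ᵥ y)‖) :
    1 / 4 * c₁ ^ 2 + 1 / 8 * m₁ + 1 / 16 * ‖Tᴴ * T + T * Tᴴ‖ ^ 2 ≤ c ^ 4 := by
  have hPh : (Tᴴ * T + T * Tᴴ).IsHermitian := by
    rw [IsHermitian, conjTranspose_add, conjTranspose_mul, conjTranspose_mul, conjTranspose_conjTranspose, add_comm]
  have hpt := fun (x : n → ℂ) (hx : star x ⬝ᵥ x = 1) => bhuniaBagPaul_thm_3_1_pointwise T hc hw hC hm hx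
  have hPP := norm_mul_self_of_isHermitian hPh
  have hpsd : ((Tᴴ * T + T * Tᴴ) * (Tᴴ * T + T * Tᴴ)).PosSemidef := by
    simpa only [hPh.eq] using posSemidef_conjTranspose_mul_self (Tᴴ * T + T * Tᴴ)
  have hnormal : IsStarNormal ((Tᴴ * T + T * Tᴴ) * (Tᴴ * T + T * Tᴴ)) := hpsd.1.isSelfAdjoint.isStarNormal
  -- `‖Px‖² = |x^*P²x| ≤ 16c⁴ − 4c₁² − 2m₁` for every unit `x`
  have hquad : ∀ x : n → ℂ, star x ⬝ᵥ x = 1 →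
      ‖star x ⬝ᵥ (((Tᴴ * T + T * Tᴴ) * (Tᴴ * T + T * Tᴴ)) *ᵥ x)‖ ≤ 16 * c ^ 4 - 4 * c₁ ^ 2 - 2 * m₁ := by
    intro x hx
    rw [norm_eq_re_of_nonneg (hpsd.dotProduct_mulVec_nonneg x), re_quadForm_mul_self_of_isHermitian hPh]
    have := hpt x hx
    linarith
  have hd0 : 0 ≤ 16 * c ^ 4 - 4 * c₁ ^ 2 - 2 * m₁ := by
    obtain ⟨i⟩ := ‹Nonempty n›
    exact (norm_nonneg _).trans (hquad (Pi.single i 1) (by simp))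
  have hnorm := norm_le_of_isStarNormal_of_forall_quadForm_le hnormal hd0 hquad
  rw [hPP] at hnorm
  linarith

end TheoremThreeOne

/-! ## § 7. Theorem 3.3 and Corollary 3.4 -/

section TheoremThreeThree

variable (T : Matrix n n ℂ)

omit [DecidableEq n] in
/-- The skew-Hermitian part `K = ½(T − T^*)` is normal. [folklore] -/
private theorem isStarNormal_skewHermitianPart' : IsStarNormal ((2 : ℂ)⁻¹ • (T - Tᴴ)) := by
  refine ⟨?_⟩
  rw [Commute, SemiconjBy, star_eq_conjTranspose, conjTranspose_skewHermitianPart, neg_mul, mul_neg]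

/-- **Theorem 3.3 (Bhunia–Bag–Paul), first inequality: `w(T) ≥ √(‖Re(T)‖² + m²(Im(T)))`** (`n ≥ 1`), def-free: if
`w(T) ≤ c` and `|Im(y^*Ty)| ≥ m₂ ≥ 0` for all unit `y` (`|y^*Ky| = |Im(y^*Ty)|` for `K = ½(T − T^*)`), then
`‖½(T + T^*)‖² + m₂² ≤ c²` (at a unit vector `x` with `|x^*(Re T)x| = ‖Re T‖`: `c² ≥ |x^*Tx|² = (x^*(Re T)x)² +
Im(x^*Tx)² ≥ ‖Re T‖² + m₂²`). [cite: BhuniaBagPaul2019, Theorem 3.3] -/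
theorem bhuniaBagPaul_thm_3_3 [Nonempty n] {c m₂ : ℝ} (hm₂ : 0 ≤ m₂)
    (hw : ∀ y : n → ℂ, star y ⬝ᵥ y = 1 → ‖star y ⬝ᵥ (T *ᵥ y)‖ ≤ c)
    (hm : ∀ y : n → ℂ, star y ⬝ᵥ y = 1 → m₂ ≤ |(star y ⬝ᵥ (T *ᵥ y)).im|) :
    ‖(2 : ℂ)⁻¹ • (T + Tᴴ)‖ ^ 2 + m₂ ^ 2 ≤ c ^ 2 := by
  obtain ⟨x, hx, hxH⟩ := exists_quadForm_norm_eq_norm_of_isStarNormal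
    (isHermitian_hermitianPart T).isSelfAdjoint.isStarNormal
  rw [norm_quadForm_hermitianPart] at hxH
  have h1 : ‖star x ⬝ᵥ (T *ᵥ x)‖ ^ 2 = |(star x ⬝ᵥ (T *ᵥ x)).re| ^ 2 + |(star x ⬝ᵥ (T *ᵥ x)).im| ^ 2 := by
    rw [sq_abs, sq_abs, Complex.sq_norm, Complex.normSq_apply]; ring
  have h2 : ‖star x ⬝ᵥ (T *ᵥ x)‖ ^ 2 ≤ c ^ 2 :=
    pow_le_pow_left₀ (norm_nonneg _) (hw x hx) 2
  have h3 : m₂ ^ 2 ≤ |(star x ⬝ᵥ (T *ᵥ x)).im| ^ 2 := pow_le_pow_left₀ hm₂ (hm x hx) 2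
  rw [← hxH]
  linarith

/-- **Theorem 3.3, second inequality: `w(T) ≥ √(‖Im(T)‖² + m²(Re(T)))`** (`n ≥ 1`), def-free with `K = ½(T − T^*)`
(`‖K‖ = ‖Im T‖`): if `w(T) ≤ c` and `|Re(y^*Ty)| ≥ m₂ ≥ 0` for all unit `y`, then `‖½(T − T^*)‖² + m₂² ≤ c²`.
[cite: BhuniaBagPaul2019, Theorem 3.3] -/
theorem bhuniaBagPaul_thm_3_3' [Nonempty n] {c m₂ : ℝ} (hm₂ : 0 ≤ m₂)
    (hw : ∀ y : n → ℂ, star y ⬝ᵥ y = 1 → ‖star y ⬝ᵥ (T *ᵥ y)‖ ≤ c)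
    (hm : ∀ y : n → ℂ, star y ⬝ᵥ y = 1 → m₂ ≤ |(star y ⬝ᵥ (T *ᵥ y)).re|) :
    ‖(2 : ℂ)⁻¹ • (T - Tᴴ)‖ ^ 2 + m₂ ^ 2 ≤ c ^ 2 := by
  obtain ⟨x, hx, hxK⟩ := exists_quadForm_norm_eq_norm_of_isStarNormal (isStarNormal_skewHermitianPart' T)
  rw [norm_quadForm_skewHermitianPart] at hxK
  have h1 : ‖star x ⬝ᵥ (T *ᵥ x)‖ ^ 2 = |(star x ⬝ᵥ (T *ᵥ x)).re| ^ 2 + |(star x ⬝ᵥ (T *ᵥ x)).im| ^ 2 := by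
    rw [sq_abs, sq_abs, Complex.sq_norm, Complex.normSq_apply]; ring
  have h2 : ‖star x ⬝ᵥ (T *ᵥ x)‖ ^ 2 ≤ c ^ 2 :=
    pow_le_pow_left₀ (norm_nonneg _) (hw x hx) 2
  have h3 : m₂ ^ 2 ≤ |(star x ⬝ᵥ (T *ᵥ x)).re| ^ 2 := pow_le_pow_left₀ hm₂ (hm x hx) 2
  rw [← hxK]
  linarith

/-- **Corollary 3.4 (Bhunia–Bag–Paul), scalar imaginary part**: if `½(T − T^*) = μ·I` (so `Im T` is the scalar
`−iμ`), then `w(T) = √(‖Re T‖² + ‖Im T‖²) = √(‖½(T + T^*)‖² + |μ|²)` (`n ≥ 1`), def-free and attained.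
[cite: BhuniaBagPaul2019, Corollary 3.4] -/
theorem isGreatest_quadForm_of_skewHermitianPart_eq_smul_one [Nonempty n] {μ : ℂ}
    (hK : (2 : ℂ)⁻¹ • (T - Tᴴ) = μ • (1 : Matrix n n ℂ)) :
    IsGreatest {r : ℝ | ∃ x : n → ℂ, star x ⬝ᵥ x = 1 ∧ ‖star x ⬝ᵥ (T *ᵥ x)‖ = r}
      (Real.sqrt (‖(2 : ℂ)⁻¹ • (T + Tᴴ)‖ ^ 2 + ‖μ‖ ^ 2)) := by
  -- every unit `x` has `|x^*Kx| = |μ|`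
  have hKx : ∀ x : n → ℂ, star x ⬝ᵥ x = 1 → ‖star x ⬝ᵥ (((2 : ℂ)⁻¹ • (T - Tᴴ)) *ᵥ x)‖ = ‖μ‖ := by
    intro x hx
    rw [hK, smul_mulVec, one_mulVec, dotProduct_smul, hx, smul_eq_mul, mul_one]
  have hKn : ‖(2 : ℂ)⁻¹ • (T - Tᴴ)‖ ≤ ‖μ‖ :=
    norm_le_of_isStarNormal_of_forall_quadForm_le (isStarNormal_skewHermitianPart' T) (norm_nonneg _)
      fun x hx => (hKx x hx).le
  -- upper bound `|x^*Tx|² ≤ ‖Re T‖² + ‖K‖² ≤ ‖Re T‖² + |μ|²`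
  have hup : ∀ x : n → ℂ, star x ⬝ᵥ x = 1 →
      ‖star x ⬝ᵥ (T *ᵥ x)‖ ≤ Real.sqrt (‖(2 : ℂ)⁻¹ • (T + Tᴴ)‖ ^ 2 + ‖μ‖ ^ 2) := by
    intro x hx
    refine Real.le_sqrt_of_sq_le ?_
    exact (norm_sq_quadForm_le_norm_sq_add_norm_sq T hx).trans
      (add_le_add le_rfl (pow_le_pow_left₀ (norm_nonneg _) hKn 2))
  -- attained at a unit vector maximising `|x^*(Re T)x|`
  obtain ⟨x, hx, hxH⟩ := exists_quadForm_norm_eq_norm_of_isStarNormal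
    (isHermitian_hermitianPart T).isSelfAdjoint.isStarNormal
  have hval : ‖star x ⬝ᵥ (T *ᵥ x)‖ = Real.sqrt (‖(2 : ℂ)⁻¹ • (T + Tᴴ)‖ ^ 2 + ‖μ‖ ^ 2) := by
    rw [← hxH, ← hKx x hx, ← norm_sq_quadForm_eq, Real.sqrt_sq (norm_nonneg _)]
  refine ⟨⟨x, hx, hval⟩, ?_⟩
  rintro r ⟨y, hy, rfl⟩
  exact hup y hy

/-- **Corollary 3.4, scalar real part**: if `½(T + T^*) = μ·I` then `w(T) = √(|μ|² + ‖½(T − T^*)‖²)` (`n ≥ 1`), attained.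
[cite: BhuniaBagPaul2019, Corollary 3.4] -/
theorem isGreatest_quadForm_of_hermitianPart_eq_smul_one [Nonempty n] {μ : ℂ}
    (hH : (2 : ℂ)⁻¹ • (T + Tᴴ) = μ • (1 : Matrix n n ℂ)) :
    IsGreatest {r : ℝ | ∃ x : n → ℂ, star x ⬝ᵥ x = 1 ∧ ‖star x ⬝ᵥ (T *ᵥ x)‖ = r}
      (Real.sqrt (‖μ‖ ^ 2 + ‖(2 : ℂ)⁻¹ • (T - Tᴴ)‖ ^ 2)) := by
  have hHx : ∀ x : n → ℂ, star x ⬝ᵥ x = 1 → ‖star x ⬝ᵥ (((2 : ℂ)⁻¹ • (T + Tᴴ)) *ᵥ x)‖ = ‖μ‖ := by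
    intro x hx
    rw [hH, smul_mulVec, one_mulVec, dotProduct_smul, hx, smul_eq_mul, mul_one]
  have hHn : ‖(2 : ℂ)⁻¹ • (T + Tᴴ)‖ ≤ ‖μ‖ :=
    norm_le_of_isStarNormal_of_forall_quadForm_le (isHermitian_hermitianPart T).isSelfAdjoint.isStarNormal
      (norm_nonneg _) fun x hx => (hHx x hx).le
  have hup : ∀ x : n → ℂ, star x ⬝ᵥ x = 1 →
      ‖star x ⬝ᵥ (T *ᵥ x)‖ ≤ Real.sqrt (‖μ‖ ^ 2 + ‖(2 : ℂ)⁻¹ • (T - Tᴴ)‖ ^ 2) := by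
    intro x hx
    refine Real.le_sqrt_of_sq_le ?_
    exact (norm_sq_quadForm_le_norm_sq_add_norm_sq T hx).trans
      (add_le_add (pow_le_pow_left₀ (norm_nonneg _) hHn 2) le_rfl)
  obtain ⟨x, hx, hxK⟩ := exists_quadForm_norm_eq_norm_of_isStarNormal (isStarNormal_skewHermitianPart' T)
  have hval : ‖star x ⬝ᵥ (T *ᵥ x)‖ = Real.sqrt (‖μ‖ ^ 2 + ‖(2 : ℂ)⁻¹ • (T - Tᴴ)‖ ^ 2) := by
    rw [← hxK, ← hHx x hx, ← norm_sq_quadForm_eq, Real.sqrt_sq (norm_nonneg _)]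
  refine ⟨⟨x, hx, hval⟩, ?_⟩
  rintro r ⟨y, hy, rfl⟩
  exact hup y hy

end TheoremThreeThree

end Literature.LinearAlgebra.Matrix.NumericalRadiusRotatedRealPart
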